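import Summits.QuantumFields.YangMills.Theorems.UnitScaleTiltProp7LandauTransversalityPairing
import HarnessLib

/-!
# Route `UnitScaleTilt`, crux K1 child «MinimiserStabilityRegPr» (stmt-QuantumFields-19200), skeleton v10, stub `stub_existenceMinimalOrbit` (EX), route (α) —
# **RESOLVENT SMOOTHING `(1 + tΔ^η_{U₀})⁻¹` ON THE MEMBER'S GAUGE PARAMETERS: THE `H²` ROW OF A PREIMAGE FROM ITS `H¹` ROW ALONE** («R2q″-SMOOTH» of the (P2-core) plan v2; cures
# TRAP 3 = ★px10 g2 LOCATE #58 (L3): the `H²` row of a framed constant `Ad_P c` is NOT η-free from `RegPr` for the stair frame (`Δ^η(Ad_P c) ∼ η⁻²·div(log a)·c ∼ ε₀∕η`), so the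
# bump-times-framed-constant preimage `S c` of R2q″ has η-free `H⁰, H¹` rows but no η-free `H²` row; replacing `S` by `S̃ := (1 + tΔ^η_{U₀})⁻¹ ∘ S` with an η-free `t > 0` gives
# `‖Δ^η(S̃c)‖ ≤ ‖D(Sc)‖∕√(2t)` from the `H¹` row alone, keeps `‖S̃c‖ ≤ ‖Sc‖`, `‖D(S̃c)‖ ≤ ‖D(Sc)‖`, and moves the field by only `‖S̃c − Sc‖ ≤ √(t∕2)·‖D(Sc)‖ — so the block
# approximation row (d) of R2q″ survives and the frame-divergence input (F2) (an N06-class regularity row) DROPS OUT of plan v2).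

The content is the elementary resolvent algebra of a positive operator `Δ = D*D` on a finite-dimensional inner-product space: for `t ≥ 0`, `1 + tD*D` is injective (`re⟪(1+tD*D)g, g⟫ =
‖g‖² + t‖Dg‖²`) hence onto, and if `g + tΔg = f` then expanding `‖f‖² = ‖g + tΔg‖²` and `‖Df‖² = ‖Dg‖² + 2t‖Δg‖² + t²‖DΔg‖²` (`D* = D†`) gives every row; no spectral calculus.

Cell `ym3-torus`, width seat `ym-ust-20520-w5` (gen 7).  THEOREMS ONLY (0 `def`, 0 `sorry`).  `--supports stmt-QuantumFields-19200 --as helper`, count-neutral.  YM₃ on T³ is a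
ladder rung (R3), not the Clay problem; nothing here claims the stub, the crux, d = 4 or the mass gap.

WHAT IS PROVED (sorry-free, no definition; ns `…Theorems.Prop7ResolventSmoothing`):
* §1 (abstract, any complex inner-product spaces `E, B`, linear `D : E → B`, `D⋆ : B → E` with `⟪D⋆x, y⟫ = ⟪x, Dy⟫`): `re_inner_resolvent` (`re⟪g + tD⋆Dg, g⟫ = ‖g‖² + t‖Dg‖²`),
  ★`exists_resolvent_eq` (`∀ f, ∃ g, g + t·D⋆Dg = f`, finite dimension), ★`exists_resolvent_linear` (the same `g = R f` with `R` LINEAR, def-free `∃ R`), `norm_sq_eq_of_resolvent` ∕ `norm_D_sq_eq_of_resolvent` (the two expansions), ★★`resolvent_rows`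
  (`‖g‖ ≤ ‖f‖`, `‖Dg‖ ≤ ‖Df‖`, `2t‖D⋆Dg‖² ≤ ‖Df‖²`, `‖f − g‖² ≤ (t∕2)‖Df‖²`, `‖D(f − g)‖ ≤ ‖Df‖`).
* §2 (the member, `D := DL2 U₀`, `D⋆ := DstarL2 U₀`, `Δ^η := covLapSite U₀`, ✓`adjoint_DL2`): ★★`exists_smoothing_rows` (the five rows at the member, plus the linear forms
  `‖Δ^η g‖ ≤ ‖Df‖∕√(2t)`, `‖f − g‖ ≤ √(t∕2)·‖Df‖`).
* §3 ★★★`exists_smoothed_preimage_rows` — for ANY preimage map `S : Y → (Site → M₂)` with η-free rows `‖toL2S (S c)‖ ≤ s₀·q c`, `‖D_{U₀}(toL2S (S c))‖ ≤ s₁·q c` and any `t > 0`: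
  every `c` has a smoothed preimage `N` with `toL2S N + t·Δ^η(toL2S N) = toL2S (S c)` and the FOUR rows `‖toL2S N‖ ≤ s₀·q c`, `‖D(toL2S N)‖ ≤ s₁·q c`, `‖Δ^η(toL2S N)‖ ≤ (s₁∕√(2t))·q c`,
  `‖toL2S N − toL2S (S c)‖ ≤ (√(t∕2)·s₁)·q c` (+ `‖D(toL2S N − toL2S (S c))‖ ≤ s₁·q c`) — the `H²`-smooth preimage R2q″'s solve door (★px10 g2 FILE 1) and ✓`hS_of_rowsZ`'s (Q4-H²) consume.
* §4 ★★★`exists_smoothing_linear` — the same smoothing as a ℂ-LINEAR map `R` on `Site → M₂` (def-free `∃ R`) with the five rows for every `f`, so that a LINEAR `H¹` preimage map `S`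
  yields the LINEAR `H²`-smooth preimage map `R ∘ₗ S` a finite-dimensional (injective ⇒ onto) solve door needs.
HONEST SCOPE.  Finite-dimensional Hilbert-space algebra; nothing of print asserted; no stub ∕ crux statement advanced.

References: T. Bałaban, CMP 99 (1985) 389–434 [Balaban1985BackgroundPropagators] ((3.8) p.392, (3.23) p.394, (3.115) p.418); CMP 102 (1985) 277–309 [Balaban1985Variational]
((45) p.285, (82)–(83) p.290).
-/

set_option autoImplicit false

noncomputable section

open scoped InnerProductSpace Matrix.Norms.L2Operator ComplexConjugate

namespace Summit.QuantumFields.YangMills.Theorems.Prop7ResolventSmoothing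

open Literature.MathematicalPhysics.QuantumFieldTheory.Balaban1983to89
open Literature.MathematicalPhysics.QuantumFieldTheory.Balaban1983to89.T3ContinuumYM3Torus
open Literature.MathematicalPhysics.QuantumFieldTheory.Balaban1983to89.T3SectALandauChart (eta eta_pos)
open B11Eq103H1Complex (SiteL2K BondL2K)
open Summit.QuantumFields.YangMills.Theorems.Prop7SectET3Transport (periodsT3)
open Summit.QuantumFields.YangMills.Theorems.Prop7SectET3HilbertLetters (W₂ toL2 toL2S DL2 DstarL2 covLapSite adjoint_DL2)

/-! ## §1 The resolvent algebra of `D⋆D` on an inner-product space -/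

section Abstract

variable {E B : Type*} [NormedAddCommGroup E] [InnerProductSpace ℂ E] [NormedAddCommGroup B] [InnerProductSpace ℂ B]
  (D : E →ₗ[ℂ] B) (Ds : B →ₗ[ℂ] E)

/-- `a² ≤ b²`, `0 ≤ b` ⟹ `a ≤ b` (real numbers). [folklore] -/
private theorem le_of_sq_le_sq_aux {a b : ℝ} (hb : 0 ≤ b) (h : a ^ 2 ≤ b ^ 2) : a ≤ b := by
  by_contra h'
  rw [not_le] at h'
  nlinarith [h', hb]

/-- **`⟪g, D⋆Dg⟫ = ‖Dg‖²`** (as a complex number) for an adjoint pair `⟪D⋆x, y⟫ = ⟪x, Dy⟫`. [cite: Balaban1985BackgroundPropagators, (3.8) p.392, (3.23) p.394] -/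
theorem inner_DsD_eq (hadj : ∀ (x : B) (y : E), ⟪Ds x, y⟫_ℂ = ⟪x, D y⟫_ℂ) (g : E) :
    ⟪g, Ds (D g)⟫_ℂ = ((‖D g‖ ^ 2 : ℝ) : ℂ) := by
  rw [← inner_conj_symm, hadj, inner_conj_symm, inner_self_eq_norm_sq_to_K]; norm_cast

/-- **`re⟪g + t·D⋆Dg, g⟫ = ‖g‖² + t‖Dg‖²`** (`t` real): the resolvent form is coercive. [cite: Balaban1985BackgroundPropagators, (3.23) p.394] -/
theorem re_inner_resolvent (hadj : ∀ (x : B) (y : E), ⟪Ds x, y⟫_ℂ = ⟪x, D y⟫_ℂ) (t : ℝ) (g : E) :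
    RCLike.re ⟪g + (t : ℂ) • Ds (D g), g⟫_ℂ = ‖g‖ ^ 2 + t * ‖D g‖ ^ 2 := by
  have h1 : ⟪Ds (D g), g⟫_ℂ = ((‖D g‖ ^ 2 : ℝ) : ℂ) := by
    rw [hadj, inner_self_eq_norm_sq_to_K]; norm_cast
  have h2 : RCLike.re (((t * ‖D g‖ ^ 2 : ℝ)) : ℂ) = t * ‖D g‖ ^ 2 := Complex.ofReal_re _
  rw [inner_add_left, map_add, inner_self_eq_norm_sq, inner_smul_left, h1, Complex.conj_ofReal, ← Complex.ofReal_mul, h2]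

/-- ★ **THE RESOLVENT EQUATION IS SOLVABLE**: on a finite-dimensional `E`, for every real `t ≥ 0` and every `f` there is `g` with `g + t·D⋆Dg = f` (`1 + tD⋆D` is injective by
coercivity, hence onto). [cite: Balaban1985BackgroundPropagators, (3.23) p.394] -/
theorem exists_resolvent_eq [FiniteDimensional ℂ E] (hadj : ∀ (x : B) (y : E), ⟪Ds x, y⟫_ℂ = ⟪x, D y⟫_ℂ) {t : ℝ} (ht : 0 ≤ t) (f : E) :
    ∃ g : E, g + (t : ℂ) • Ds (D g) = f := by
  set Φ : E →ₗ[ℂ] E := LinearMap.id + (t : ℂ) • (Ds ∘ₗ D) with hΦ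
  have hΦapp : ∀ g : E, Φ g = g + (t : ℂ) • Ds (D g) := fun g => rfl
  have hinj : Function.Injective Φ := by
    rw [← LinearMap.ker_eq_bot, LinearMap.ker_eq_bot']
    intro g hg
    have h1 : RCLike.re ⟪Φ g, g⟫_ℂ = ‖g‖ ^ 2 + t * ‖D g‖ ^ 2 := by rw [hΦapp]; exact re_inner_resolvent D Ds hadj t g
    rw [hg, inner_zero_left, map_zero] at h1
    have h2 : ‖g‖ ^ 2 = 0 := by nlinarith [sq_nonneg ‖g‖, mul_nonneg ht (sq_nonneg ‖D g‖)]
    exact norm_eq_zero.1 ((pow_eq_zero_iff two_ne_zero).1 h2)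
  have hsurj : Function.Surjective Φ := LinearMap.surjective_of_injective hinj
  obtain ⟨g, hg⟩ := hsurj f
  exact ⟨g, by rw [← hΦapp]; exact hg⟩

/-- ★ **THE RESOLVENT AS A LINEAR MAP** (def-free packaging): on a finite-dimensional `E`, for every real `t ≥ 0` there is a LINEAR `R : E →ₗ E` with `R f + t·D⋆D(R f) = f` for all `f`
(`R := (1 + tD⋆D)⁻¹` via `LinearEquiv.ofInjectiveEndo`). [cite: Balaban1985BackgroundPropagators, (3.23) p.394] -/
theorem exists_resolvent_linear [FiniteDimensional ℂ E] (hadj : ∀ (x : B) (y : E), ⟪Ds x, y⟫_ℂ = ⟪x, D y⟫_ℂ) {t : ℝ} (ht : 0 ≤ t) :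
    ∃ R : E →ₗ[ℂ] E, ∀ f : E, R f + (t : ℂ) • Ds (D (R f)) = f := by
  set Φ : E →ₗ[ℂ] E := LinearMap.id + (t : ℂ) • (Ds ∘ₗ D) with hΦ
  have hΦapp : ∀ g : E, Φ g = g + (t : ℂ) • Ds (D g) := fun g => rfl
  have hinj : Function.Injective Φ := by
    rw [← LinearMap.ker_eq_bot, LinearMap.ker_eq_bot']
    intro g hg
    have h1 : RCLike.re ⟪Φ g, g⟫_ℂ = ‖g‖ ^ 2 + t * ‖D g‖ ^ 2 := by rw [hΦapp]; exact re_inner_resolvent D Ds hadj t g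
    rw [hg, inner_zero_left, map_zero] at h1
    have h2 : ‖g‖ ^ 2 = 0 := by nlinarith [sq_nonneg ‖g‖, mul_nonneg ht (sq_nonneg ‖D g‖)]
    exact norm_eq_zero.1 ((pow_eq_zero_iff two_ne_zero).1 h2)
  refine ⟨((LinearEquiv.ofInjectiveEndo Φ hinj).symm : E →ₗ[ℂ] E), fun f => ?_⟩
  have h3 : Φ ((LinearEquiv.ofInjectiveEndo Φ hinj).symm f) = f := by
    rw [← LinearEquiv.coe_ofInjectiveEndo Φ hinj, LinearEquiv.apply_symm_apply]
  rw [hΦapp] at h3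
  exact h3

/-- **`‖g + tD⋆Dg‖² = ‖g‖² + 2t‖Dg‖² + t²‖D⋆Dg‖²`** (`t` real). [cite: Balaban1985BackgroundPropagators, (3.23) p.394] -/
theorem norm_sq_eq_of_resolvent (hadj : ∀ (x : B) (y : E), ⟪Ds x, y⟫_ℂ = ⟪x, D y⟫_ℂ) (t : ℝ) (g : E) :
    ‖g + (t : ℂ) • Ds (D g)‖ ^ 2 = ‖g‖ ^ 2 + 2 * t * ‖D g‖ ^ 2 + t ^ 2 * ‖Ds (D g)‖ ^ 2 := by
  rw [norm_add_sq (𝕜 := ℂ), inner_smul_right, inner_DsD_eq D Ds hadj, norm_smul, Complex.norm_real, Real.norm_eq_abs, mul_pow, sq_abs]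
  have : RCLike.re ((t : ℂ) * (((‖D g‖ ^ 2 : ℝ)) : ℂ)) = t * ‖D g‖ ^ 2 := by
    rw [← Complex.ofReal_mul]; exact Complex.ofReal_re _
  rw [this]; ring

/-- **`‖D(g + tD⋆Dg)‖² = ‖Dg‖² + 2t‖D⋆Dg‖² + t²‖D(D⋆Dg)‖²`** (`t` real; `⟪Dg, D(D⋆Dg)⟫ = ‖D⋆Dg‖²`). [cite: Balaban1985BackgroundPropagators, (3.8) p.392, (3.23) p.394] -/
theorem norm_D_sq_eq_of_resolvent (hadj : ∀ (x : B) (y : E), ⟪Ds x, y⟫_ℂ = ⟪x, D y⟫_ℂ) (t : ℝ) (g : E) :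
    ‖D (g + (t : ℂ) • Ds (D g))‖ ^ 2 = ‖D g‖ ^ 2 + 2 * t * ‖Ds (D g)‖ ^ 2 + t ^ 2 * ‖D (Ds (D g))‖ ^ 2 := by
  have h1 : ⟪D g, D (Ds (D g))⟫_ℂ = ((‖Ds (D g)‖ ^ 2 : ℝ) : ℂ) := by
    rw [← hadj, inner_self_eq_norm_sq_to_K]; norm_cast
  rw [map_add, map_smul, norm_add_sq (𝕜 := ℂ), inner_smul_right, h1, norm_smul, Complex.norm_real, Real.norm_eq_abs, mul_pow, sq_abs]
  have : RCLike.re ((t : ℂ) * (((‖Ds (D g)‖ ^ 2 : ℝ)) : ℂ)) = t * ‖Ds (D g)‖ ^ 2 := by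
    rw [← Complex.ofReal_mul]; exact Complex.ofReal_re _
  rw [this]; ring

/-- ★★ **THE RESOLVENT ROWS.**  If `g + t·D⋆Dg = f` with `t > 0`, then `‖g‖ ≤ ‖f‖`, `‖Dg‖ ≤ ‖Df‖`, `2t‖D⋆Dg‖² ≤ ‖Df‖²`, `‖f − g‖² ≤ (t∕2)‖Df‖²`, `‖D(f − g)‖ ≤ ‖Df‖`
(from the two expansions). [cite: Balaban1985BackgroundPropagators, (3.8) p.392, (3.23) p.394, (3.115) p.418] -/
theorem resolvent_rows (hadj : ∀ (x : B) (y : E), ⟪Ds x, y⟫_ℂ = ⟪x, D y⟫_ℂ) {t : ℝ} (ht : 0 < t) {f g : E} (hfg : g + (t : ℂ) • Ds (D g) = f) :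
    ‖g‖ ≤ ‖f‖ ∧ ‖D g‖ ≤ ‖D f‖ ∧ 2 * t * ‖Ds (D g)‖ ^ 2 ≤ ‖D f‖ ^ 2 ∧ ‖f - g‖ ^ 2 ≤ t / 2 * ‖D f‖ ^ 2 ∧ ‖D (f - g)‖ ≤ ‖D f‖ := by
  have e0 := norm_sq_eq_of_resolvent D Ds hadj t g
  have e1 := norm_D_sq_eq_of_resolvent D Ds hadj t g
  rw [hfg] at e0 e1
  have hA : 0 ≤ ‖D g‖ ^ 2 := sq_nonneg _
  have hB : 0 ≤ ‖Ds (D g)‖ ^ 2 := sq_nonneg _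
  have hC : 0 ≤ ‖D (Ds (D g))‖ ^ 2 := sq_nonneg _
  have hfg' : f - g = (t : ℂ) • Ds (D g) := by rw [← hfg]; abel
  have hnt : ‖(t : ℂ) • Ds (D g)‖ ^ 2 = t ^ 2 * ‖Ds (D g)‖ ^ 2 := by
    rw [norm_smul, Complex.norm_real, Real.norm_eq_abs, mul_pow, sq_abs]
  have hntD : ‖D ((t : ℂ) • Ds (D g))‖ ^ 2 = t ^ 2 * ‖D (Ds (D g))‖ ^ 2 := by
    rw [map_smul, norm_smul, Complex.norm_real, Real.norm_eq_abs, mul_pow, sq_abs]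
  refine ⟨?_, ?_, ?_, ?_, ?_⟩
  · exact le_of_sq_le_sq_aux (norm_nonneg _) (by nlinarith)
  · exact le_of_sq_le_sq_aux (norm_nonneg _) (by nlinarith)
  · nlinarith
  · rw [hfg', hnt]; nlinarith
  · refine le_of_sq_le_sq_aux (norm_nonneg _) ?_
    rw [hfg', hntD]; nlinarith

end Abstract

/-! ## §2 At the member: `(1 + tΔ^η_{U₀})⁻¹` -/

variable (F : T3Family) {n K : ℕ} {c₀ : ℝ} [Fact (0 < c₀)]

/-- ★★ **RESOLVENT SMOOTHING AT THE MEMBER.**  For `t > 0` and every gauge parameter `f` there is `g` with `g + t·Δ^η_{U₀}g = f` and `‖g‖ ≤ ‖f‖`, `‖D_{U₀}g‖ ≤ ‖D_{U₀}f‖`,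
`2t‖Δ^η_{U₀}g‖² ≤ ‖D_{U₀}f‖²`, `‖f − g‖² ≤ (t∕2)‖D_{U₀}f‖²`, `‖D_{U₀}(f − g)‖ ≤ ‖D_{U₀}f‖`, and the linear forms `‖Δ^η_{U₀}g‖ ≤ ‖D_{U₀}f‖∕√(2t)`, `‖f − g‖ ≤ √(t∕2)·‖D_{U₀}f‖`
(`D* = D†` ✓`adjoint_DL2`, `Δ^η = D*D`). [cite: Balaban1985BackgroundPropagators, (3.8) p.392, (3.23) p.394, (3.115) p.418] -/
theorem exists_smoothing_rows (U₀ : GaugeField (F.P K) 0 (Matrix.specialUnitaryGroup (Fin 2) ℂ)) {t : ℝ} (ht : 0 < t) (f : SiteL2K ℂ 3 (periodsT3 F K) c₀ W₂) :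
    ∃ g : SiteL2K ℂ 3 (periodsT3 F K) c₀ W₂, g + (t : ℂ) • covLapSite F n K c₀ U₀ g = f ∧
      ‖g‖ ≤ ‖f‖ ∧ ‖DL2 F n K c₀ U₀ g‖ ≤ ‖DL2 F n K c₀ U₀ f‖ ∧ 2 * t * ‖covLapSite F n K c₀ U₀ g‖ ^ 2 ≤ ‖DL2 F n K c₀ U₀ f‖ ^ 2 ∧
      ‖f - g‖ ^ 2 ≤ t / 2 * ‖DL2 F n K c₀ U₀ f‖ ^ 2 ∧ ‖DL2 F n K c₀ U₀ (f - g)‖ ≤ ‖DL2 F n K c₀ U₀ f‖ ∧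
      ‖covLapSite F n K c₀ U₀ g‖ ≤ ‖DL2 F n K c₀ U₀ f‖ / Real.sqrt (2 * t) ∧ ‖f - g‖ ≤ Real.sqrt (t / 2) * ‖DL2 F n K c₀ U₀ f‖ := by
  have hadj : ∀ (x : BondL2K ℂ 3 (periodsT3 F K) c₀ W₂) (y : SiteL2K ℂ 3 (periodsT3 F K) c₀ W₂),
      ⟪DstarL2 F n K c₀ U₀ x, y⟫_ℂ = ⟪x, DL2 F n K c₀ U₀ y⟫_ℂ := fun x y => by
    rw [← adjoint_DL2, LinearMap.adjoint_inner_left]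
  obtain ⟨g, hg⟩ := exists_resolvent_eq (DL2 F n K c₀ U₀) (DstarL2 F n K c₀ U₀) hadj ht.le f
  have hΔ : ∀ v, DstarL2 F n K c₀ U₀ (DL2 F n K c₀ U₀ v) = covLapSite F n K c₀ U₀ v := fun v => rfl
  obtain ⟨r0, r1, r2, r3, r4⟩ := resolvent_rows (DL2 F n K c₀ U₀) (DstarL2 F n K c₀ U₀) hadj ht hg
  rw [hΔ] at hg r2
  have h2t : 0 < Real.sqrt (2 * t) := Real.sqrt_pos.2 (by linarith)
  refine ⟨g, hg, r0, r1, r2, r3, r4, ?_, ?_⟩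
  · rw [le_div_iff₀ h2t]
    refine le_of_sq_le_sq_aux (norm_nonneg _) ?_
    rw [mul_pow, Real.sq_sqrt (by linarith)]
    nlinarith
  · refine le_of_sq_le_sq_aux (mul_nonneg (Real.sqrt_nonneg _) (norm_nonneg _)) ?_
    rw [mul_pow, Real.sq_sqrt (by linarith)]
    exact r3

/-! ## §3 The smoothed preimage rows -/

/-- ★★★ **THE `H²`-SMOOTH PREIMAGE FROM AN `H¹` PREIMAGE** (R2q″-SMOOTH).  Let `S : Y → (Site → M₂)` be any preimage map with η-free rows `‖toL2S (S c)‖ ≤ s₀·q c` and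
`‖D_{U₀}(toL2S (S c))‖ ≤ s₁·q c` against any size functional `q` (R2q″'s bump × framed constant: `H⁰` exact, `H¹` from the frame's bond row (F1)), and `t > 0`.  THEN every `c` has a
smoothed preimage `N` (`toL2S N := (1 + tΔ^η_{U₀})⁻¹ toL2S (S c)`) with: `toL2S N + t·Δ^η_{U₀}(toL2S N) = toL2S (S c)`; `‖toL2S N‖ ≤ s₀·q c`; `‖D_{U₀}(toL2S N)‖ ≤ s₁·q c`; THE `H²` ROW
`‖Δ^η_{U₀}(toL2S N)‖ ≤ (s₁∕√(2t))·q c`; the displacement rows `‖toL2S N − toL2S (S c)‖ ≤ (√(t∕2)·s₁)·q c`, `‖D_{U₀}(toL2S N − toL2S (S c))‖ ≤ s₁·q c` (so the block approximation row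
(d) of R2q″ transfers from `S` to the smoothed preimage with an η-free loss `∝ √t`). [cite: Balaban1985BackgroundPropagators, (3.8) p.392, (3.23) p.394, (3.115) p.418;
Balaban1985Variational, (45) p.285] -/
theorem exists_smoothed_preimage_rows (U₀ : GaugeField (F.P K) 0 (Matrix.specialUnitaryGroup (Fin 2) ℂ)) {Y : Type*} (S : Y → (Site (F.P K) 0 → Matrix (Fin 2) (Fin 2) ℂ))
    (q : Y → ℝ) {s₀ s₁ t : ℝ} (ht : 0 < t)
    (hS0 : ∀ c, ‖toL2S F K c₀ (S c)‖ ≤ s₀ * q c) (hS1 : ∀ c, ‖DL2 F n K c₀ U₀ (toL2S F K c₀ (S c))‖ ≤ s₁ * q c) :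
    ∀ c : Y, ∃ N : Site (F.P K) 0 → Matrix (Fin 2) (Fin 2) ℂ,
      toL2S F K c₀ N + (t : ℂ) • covLapSite F n K c₀ U₀ (toL2S F K c₀ N) = toL2S F K c₀ (S c) ∧
      ‖toL2S F K c₀ N‖ ≤ s₀ * q c ∧ ‖DL2 F n K c₀ U₀ (toL2S F K c₀ N)‖ ≤ s₁ * q c ∧
      ‖covLapSite F n K c₀ U₀ (toL2S F K c₀ N)‖ ≤ s₁ / Real.sqrt (2 * t) * q c ∧
      ‖toL2S F K c₀ N - toL2S F K c₀ (S c)‖ ≤ Real.sqrt (t / 2) * s₁ * q c ∧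
      ‖DL2 F n K c₀ U₀ (toL2S F K c₀ N - toL2S F K c₀ (S c))‖ ≤ s₁ * q c := by
  intro c
  obtain ⟨g, hg, r0, r1, -, -, r4, r5, r6⟩ := exists_smoothing_rows F U₀ ht (toL2S F K c₀ (S c))
  have h2t : 0 < Real.sqrt (2 * t) := Real.sqrt_pos.2 (by linarith)
  refine ⟨(toL2S F K c₀).symm g, ?_, ?_, ?_, ?_, ?_, ?_⟩ <;> simp only [LinearEquiv.apply_symm_apply]
  · exact hg
  · exact r0.trans (hS0 c)
  · exact r1.trans (hS1 c)
  · calc ‖covLapSite F n K c₀ U₀ g‖ ≤ ‖DL2 F n K c₀ U₀ (toL2S F K c₀ (S c))‖ / Real.sqrt (2 * t) := r5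
      _ ≤ s₁ * q c / Real.sqrt (2 * t) := div_le_div_of_nonneg_right (hS1 c) h2t.le
      _ = s₁ / Real.sqrt (2 * t) * q c := by ring
  · rw [norm_sub_rev]
    calc ‖toL2S F K c₀ (S c) - g‖ ≤ Real.sqrt (t / 2) * ‖DL2 F n K c₀ U₀ (toL2S F K c₀ (S c))‖ := r6
      _ ≤ Real.sqrt (t / 2) * (s₁ * q c) := mul_le_mul_of_nonneg_left (hS1 c) (Real.sqrt_nonneg _)
      _ = Real.sqrt (t / 2) * s₁ * q c := by ring
  · rw [← norm_neg, ← map_neg, neg_sub]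
    exact r4.trans (hS1 c)

/-! ## §4 The smoothing as a linear map on gauge parameters (for linear solve doors) -/

/-- ★★★ **RESOLVENT SMOOTHING AS A LINEAR MAP ON `Site → M₂` WITH ITS ROWS** (def-free: `∃ R`).  For `t > 0` there is a ℂ-LINEAR `R` on gauge parameters with, for every `f`:
`toL2S (R f) + t·Δ^η_{U₀}(toL2S (R f)) = toL2S f`, `‖toL2S (R f)‖ ≤ ‖toL2S f‖`, `‖D_{U₀}(toL2S (R f))‖ ≤ ‖D_{U₀}(toL2S f)‖`, THE `H²` ROW `‖Δ^η_{U₀}(toL2S (R f))‖ ≤ ‖D_{U₀}(toL2S f)‖∕√(2t)`,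
`‖toL2S (R f) − toL2S f‖ ≤ √(t∕2)·‖D_{U₀}(toL2S f)‖`, `‖D_{U₀}(toL2S (R f) − toL2S f)‖ ≤ ‖D_{U₀}(toL2S f)‖` — so a LINEAR `H¹` preimage map `S` of R2q″ gives the LINEAR `H²`-smooth
preimage map `R ∘ₗ S` the finite-dimensional solve door (★px10 g2 `Prop7RightInverseOfApprox.exists_rightInverse_of_approx_gauge`) consumes.
[cite: Balaban1985BackgroundPropagators, (3.8) p.392, (3.23) p.394, (3.115) p.418; Balaban1985Variational, (45) p.285] -/
theorem exists_smoothing_linear (U₀ : GaugeField (F.P K) 0 (Matrix.specialUnitaryGroup (Fin 2) ℂ)) {t : ℝ} (ht : 0 < t) :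
    ∃ R : (Site (F.P K) 0 → Matrix (Fin 2) (Fin 2) ℂ) →ₗ[ℂ] (Site (F.P K) 0 → Matrix (Fin 2) (Fin 2) ℂ),
      ∀ f : Site (F.P K) 0 → Matrix (Fin 2) (Fin 2) ℂ,
        toL2S F K c₀ (R f) + (t : ℂ) • covLapSite F n K c₀ U₀ (toL2S F K c₀ (R f)) = toL2S F K c₀ f ∧
        ‖toL2S F K c₀ (R f)‖ ≤ ‖toL2S F K c₀ f‖ ∧ ‖DL2 F n K c₀ U₀ (toL2S F K c₀ (R f))‖ ≤ ‖DL2 F n K c₀ U₀ (toL2S F K c₀ f)‖ ∧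
        ‖covLapSite F n K c₀ U₀ (toL2S F K c₀ (R f))‖ ≤ ‖DL2 F n K c₀ U₀ (toL2S F K c₀ f)‖ / Real.sqrt (2 * t) ∧
        ‖toL2S F K c₀ (R f) - toL2S F K c₀ f‖ ≤ Real.sqrt (t / 2) * ‖DL2 F n K c₀ U₀ (toL2S F K c₀ f)‖ ∧
        ‖DL2 F n K c₀ U₀ (toL2S F K c₀ (R f) - toL2S F K c₀ f)‖ ≤ ‖DL2 F n K c₀ U₀ (toL2S F K c₀ f)‖ := by
  have hadj : ∀ (x : BondL2K ℂ 3 (periodsT3 F K) c₀ W₂) (y : SiteL2K ℂ 3 (periodsT3 F K) c₀ W₂),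
      ⟪DstarL2 F n K c₀ U₀ x, y⟫_ℂ = ⟪x, DL2 F n K c₀ U₀ y⟫_ℂ := fun x y => by
    rw [← adjoint_DL2, LinearMap.adjoint_inner_left]
  obtain ⟨R', hR'⟩ := exists_resolvent_linear (DL2 F n K c₀ U₀) (DstarL2 F n K c₀ U₀) hadj ht.le
  have hΔ : ∀ v, DstarL2 F n K c₀ U₀ (DL2 F n K c₀ U₀ v) = covLapSite F n K c₀ U₀ v := fun v => rfl
  have h2t : 0 < Real.sqrt (2 * t) := Real.sqrt_pos.2 (by linarith)
  refine ⟨((toL2S F K c₀).symm : SiteL2K ℂ 3 (periodsT3 F K) c₀ W₂ →ₗ[ℂ] (Site (F.P K) 0 → Matrix (Fin 2) (Fin 2) ℂ)) ∘ₗ R' ∘ₗ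
      ((toL2S F K c₀ : (Site (F.P K) 0 → Matrix (Fin 2) (Fin 2) ℂ) ≃ₗ[ℂ] SiteL2K ℂ 3 (periodsT3 F K) c₀ W₂) :
        (Site (F.P K) 0 → Matrix (Fin 2) (Fin 2) ℂ) →ₗ[ℂ] SiteL2K ℂ 3 (periodsT3 F K) c₀ W₂), fun f => ?_⟩
  have happ : toL2S F K c₀ ((((toL2S F K c₀).symm : SiteL2K ℂ 3 (periodsT3 F K) c₀ W₂ →ₗ[ℂ] (Site (F.P K) 0 → Matrix (Fin 2) (Fin 2) ℂ)) ∘ₗ R' ∘ₗ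
      ((toL2S F K c₀ : (Site (F.P K) 0 → Matrix (Fin 2) (Fin 2) ℂ) ≃ₗ[ℂ] SiteL2K ℂ 3 (periodsT3 F K) c₀ W₂) :
        (Site (F.P K) 0 → Matrix (Fin 2) (Fin 2) ℂ) →ₗ[ℂ] SiteL2K ℂ 3 (periodsT3 F K) c₀ W₂)) f) = R' (toL2S F K c₀ f) := by
    simp only [LinearMap.coe_comp, Function.comp_apply, LinearEquiv.coe_coe, LinearEquiv.apply_symm_apply]
  rw [happ]
  have hg := hR' (toL2S F K c₀ f)
  obtain ⟨r0, r1, r2, r3, r4⟩ := resolvent_rows (DL2 F n K c₀ U₀) (DstarL2 F n K c₀ U₀) hadj ht hg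
  rw [hΔ] at hg r2
  refine ⟨hg, r0, r1, ?_, ?_, ?_⟩
  · rw [le_div_iff₀ h2t]
    refine le_of_sq_le_sq_aux (norm_nonneg _) ?_
    rw [mul_pow, Real.sq_sqrt (by linarith)]
    nlinarith
  · rw [norm_sub_rev]
    refine le_of_sq_le_sq_aux (mul_nonneg (Real.sqrt_nonneg _) (norm_nonneg _)) ?_
    rw [mul_pow, Real.sq_sqrt (by linarith)]
    exact r3
  · rw [← norm_neg, ← map_neg, neg_sub]
    exact r4

end Summit.QuantumFields.YangMills.Theorems.Prop7ResolventSmoothing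

end
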